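import Mathlib
import Literature.MathematicalPhysics.QuantumLattice.FinDimSpectrum
import Literature.MathematicalPhysics.QuantumManyBody.PeriodicEnergyFirstVariation
import Summits.HubbardSuperconductivity.HubbardSuperconductivity.Theorems.NodalDiracTwistDiskTrivialHolonomyOverlap

/-!
# Route `NodalDiracTwist` — support `NodalDiracWeakCoupling` (line `birth`): the real frame

Helper file for stmt-HubbardSuperconductivity-10370 (`NodalDiracWeakCoupling`), stub `coneFrame`.
Pointwise linear algebra at an exactly two-fold level `E₀` of a Hermitian matrix `A` inside a
sector `K ≤ (ι → ℂ)` (`A K ⊆ K`), in the presence of an antiunitary involution `T`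
(conjugate-linear, `T² = 1`, `⟨T u, T v⟩ = conj ⟨u, v⟩`, preserving `K`, commuting with `A`):

* the `E₀`-eigenspace of `A` in `K` has a `T`-REAL orthonormal basis `e₁, e₂` (Wigner 1932;
  Hatsugai, J. Phys. Soc. Jpn. 75 (2006) 123601: an antiunitary `T` with `T² = 1` is a real
  structure — symmetrise `v + T v`, or take `I • v` when `T v = -v`, then Gram–Schmidt);
* **spectral gap**: on the unit vectors of `K` orthogonal to `e₁, e₂` the Rayleigh quotient is
  bounded below by `E₀ + g` with `g > 0` (Kato, *Perturbation Theory for Linear Operators* (1966),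
  I §6: the minimum of the Rayleigh quotient on a compact unit sphere is attained, a minimiser with
  value `E₀` would be an `E₀`-eigenvector by the variational lemma, hence in `span {e₁, e₂}`,
  hence zero).

Main result `stub_coneFrame`; the other declarations are the folklore lemmas it is assembled from
(Hermitian symmetry of `⟨u, A v⟩`, real normalisation, realification under `T`, the variational
lemma on a subspace, and "two orthonormal vectors of a two-dimensional span span it").
No new definitions.
-/

-- the mandated namespace `Summit.<Summit>.<Problem>.Theorems` repeats `HubbardSuperconductivity`
-- (single-problem summit, D-0017), which the `dupNamespace` linter flags on every declaration
set_option linter.dupNamespace false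

namespace Summit.HubbardSuperconductivity.HubbardSuperconductivity.Theorems.NodalDiracTwist

open Matrix Complex
open scoped ComplexOrder

variable {ι : Type*} [Fintype ι]

/-! ### Hermitian forms `⟨u, A v⟩ = star u ⬝ᵥ A *ᵥ v` -/

/-- Hermitian symmetry: `conj ⟨v, A u⟩ = ⟨u, A v⟩` for Hermitian `A`. [folklore] -/
theorem star_star_dotProduct_mulVec {A : Matrix ι ι ℂ} (hA : A.IsHermitian) (u v : ι → ℂ) :
    star (star v ⬝ᵥ A *ᵥ u) = star u ⬝ᵥ A *ᵥ v := by
  rw [star_dotProduct v (A *ᵥ u), star_star, star_mulVec, hA.eq, dotProduct_mulVec]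

/-- Expansion of a Hermitian form along a real line:
`re ⟨u + t w, A (u + t w)⟩ = re ⟨u, A u⟩ + 2 t re ⟨w, A u⟩ + t² re ⟨w, A w⟩`. [folklore] -/
theorem re_form_add_ofReal_smul {A : Matrix ι ι ℂ} (hA : A.IsHermitian) (u w : ι → ℂ) (t : ℝ) :
    (star (u + (t : ℂ) • w) ⬝ᵥ A *ᵥ (u + (t : ℂ) • w)).re =
      (star u ⬝ᵥ A *ᵥ u).re + 2 * t * (star w ⬝ᵥ A *ᵥ u).re +
        t ^ 2 * (star w ⬝ᵥ A *ᵥ w).re := by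
  have hsymm : (star u ⬝ᵥ A *ᵥ w).re = (star w ⬝ᵥ A *ᵥ u).re := by
    rw [← star_star_dotProduct_mulVec hA w u, Complex.star_def, Complex.conj_re]
  have ht : star (t : ℂ) = (t : ℂ) := by rw [Complex.star_def, Complex.conj_ofReal]
  rw [star_add, star_smul, ht]
  simp only [add_dotProduct, dotProduct_add, mulVec_add, mulVec_smul, smul_dotProduct,
    dotProduct_smul, smul_eq_mul, Complex.add_re, Complex.re_ofReal_mul]
  rw [hsymm]
  ring

/-- **Variational lemma on a subspace.** If the Hermitian form `re ⟨w, B w⟩` is nonnegative on a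
subspace `P` and vanishes at `χ₀ ∈ P`, then `B χ₀ ⊥ P` (first variation along `χ₀ + t w` and
`χ₀ + t (z • w)`; the real quadratic step is `BoseGas.eq_zero_of_forall_quadratic_nonneg`).
Kato (1966) I §6.10. [folklore] -/
theorem dotProduct_mulVec_eq_zero_of_form_eq_zero {B : Matrix ι ι ℂ} (hB : B.IsHermitian)
    (P : Submodule ℂ (ι → ℂ)) (hpos : ∀ w ∈ P, 0 ≤ (star w ⬝ᵥ B *ᵥ w).re) {χ₀ : ι → ℂ}
    (hχ₀ : χ₀ ∈ P) (h0 : (star χ₀ ⬝ᵥ B *ᵥ χ₀).re = 0) :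
    ∀ w ∈ P, star w ⬝ᵥ B *ᵥ χ₀ = 0 := by
  have hre : ∀ w ∈ P, (star w ⬝ᵥ B *ᵥ χ₀).re = 0 := by
    intro w hw
    refine Literature.MathematicalPhysics.QuantumManyBody.BoseGas.eq_zero_of_forall_quadratic_nonneg
      (hpos w hw) fun t => ?_
    have h := hpos (χ₀ + (t : ℂ) • w) (P.add_mem hχ₀ (P.smul_mem _ hw))
    rwa [re_form_add_ofReal_smul hB, h0, zero_add] at h
  intro w hw
  have h := hre ((star w ⬝ᵥ B *ᵥ χ₀) • w) (P.smul_mem _ hw)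
  rw [star_smul, smul_dotProduct, smul_eq_mul, Complex.star_def, ← Complex.normSq_eq_conj_mul_self,
    Complex.ofReal_re] at h
  exact Complex.normSq_eq_zero.1 h

/-! ### Normalisation by a real scalar; homogeneous form of a Rayleigh bound -/

/-- A nonzero vector has a unit multiple by a REAL scalar (`r = ⟨v, v⟩^{-1/2}`). [folklore] -/
theorem exists_ofReal_smul_unit {v : ι → ℂ} (hv : v ≠ 0) :
    ∃ r : ℝ, star ((r : ℂ) • v) ⬝ᵥ ((r : ℂ) • v) = 1 := by
  set s : ℝ := (star v ⬝ᵥ v).re with hs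
  have hs0 : 0 < s := (Complex.pos_iff.1 (dotProduct_star_self_pos_iff.2 hv)).1
  have hvs : star v ⬝ᵥ v = (s : ℂ) := by
    rw [hs, star_dotProduct_self_eq_sum, Complex.ofReal_re]
  refine ⟨(Real.sqrt s)⁻¹, ?_⟩
  rw [star_smul_dotProduct_smul, hvs, ← Complex.ofReal_mul, Complex.ofReal_eq_one,
    Complex.norm_real, Real.norm_eq_abs, abs_inv, inv_pow, sq_abs, Real.sq_sqrt hs0.le,
    inv_mul_cancel₀ hs0.ne']

/-- Scaling: a lower bound `c` for the Rayleigh quotient on the unit vectors of a subspace `P`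
gives the homogeneous bound `c · re ⟨v, v⟩ ≤ re ⟨v, A v⟩` on all of `P`. [folklore] -/
theorem mul_re_le_rayleigh_of_unit {A : Matrix ι ι ℂ} (P : Submodule ℂ (ι → ℂ)) {c : ℝ}
    (h : ∀ v ∈ P, star v ⬝ᵥ v = 1 → c ≤ (star v ⬝ᵥ A *ᵥ v).re) :
    ∀ v ∈ P, c * (star v ⬝ᵥ v).re ≤ (star v ⬝ᵥ A *ᵥ v).re := by
  intro v hv
  by_cases hv0 : v = 0
  · subst hv0
    simp
  obtain ⟨r, hr⟩ := exists_ofReal_smul_unit hv0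
  have hvs : star v ⬝ᵥ v = ((star v ⬝ᵥ v).re : ℂ) := by
    rw [star_dotProduct_self_eq_sum, Complex.ofReal_re]
  have hs0 : 0 ≤ (star v ⬝ᵥ v).re := by
    rw [star_dotProduct_self_re]
    positivity
  have h1 := h _ (P.smul_mem _ hv) hr
  rw [mulVec_smul, star_smul_dotProduct_smul, Complex.re_ofReal_mul] at h1
  rw [star_smul_dotProduct_smul, hvs, ← Complex.ofReal_mul, Complex.ofReal_eq_one] at hr
  calc c * (star v ⬝ᵥ v).re
      ≤ ‖(r : ℂ)‖ ^ 2 * (star v ⬝ᵥ A *ᵥ v).re * (star v ⬝ᵥ v).re :=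
        mul_le_mul_of_nonneg_right h1 hs0
    _ = (star v ⬝ᵥ A *ᵥ v).re * (‖(r : ℂ)‖ ^ 2 * (star v ⬝ᵥ v).re) := by ring
    _ = (star v ⬝ᵥ A *ᵥ v).re := by rw [hr, mul_one]

/-! ### Real structure: fixed vectors of an antiunitary involution -/

/-- **Realification.** For a conjugate-linear involution `T` preserving a subspace `P` and
satisfying `⟨T u, T v⟩ = conj ⟨u, v⟩`, every nonzero `v ∈ P` yields a nonzero `T`-fixed vector of
`P` (`v + T v`, or `I • v` if `T v = -v`), still orthogonal to any `T`-fixed `e ⊥ v`.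
Wigner (1932); Hatsugai, J. Phys. Soc. Jpn. 75 (2006) 123601. [folklore] -/
theorem exists_fixed_of_antiunitary {T : (ι → ℂ) → (ι → ℂ)}
    (hTs : ∀ (c : ℂ) (v : ι → ℂ), T (c • v) = star c • T v)
    (hTadd : ∀ u v : ι → ℂ, T (u + v) = T u + T v) (hTT : ∀ v : ι → ℂ, T (T v) = v)
    (hTd : ∀ u v : ι → ℂ, star (T u) ⬝ᵥ T v = star (star u ⬝ᵥ v))
    (P : Submodule ℂ (ι → ℂ)) (hTP : ∀ v ∈ P, T v ∈ P) {v : ι → ℂ} (hv : v ∈ P) (hv0 : v ≠ 0)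
    {e : ι → ℂ} (he : T e = e) (hev : star e ⬝ᵥ v = 0) :
    ∃ f ∈ P, f ≠ 0 ∧ T f = f ∧ star e ⬝ᵥ f = 0 := by
  have heT : star e ⬝ᵥ T v = 0 := by
    have h := hTd e v
    rwa [he, hev, star_zero] at h
  by_cases hsum : v + T v = 0
  · have hTv : T v = -v := eq_neg_of_add_eq_zero_right hsum
    refine ⟨I • v, P.smul_mem I hv, smul_ne_zero I_ne_zero hv0, ?_, ?_⟩
    · rw [hTs, hTv, Complex.star_def, Complex.conj_I, smul_neg, neg_smul, neg_neg]
    · rw [dotProduct_smul, hev, smul_zero]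
  · refine ⟨v + T v, P.add_mem hv (hTP v hv), hsum, ?_, ?_⟩
    · rw [hTadd, hTT, add_comm]
    · rw [dotProduct_add, hev, heT, add_zero]

/-! ### Two orthonormal vectors of a two-dimensional span -/

/-- If `e₁, e₂` are orthonormal vectors of `span {ψ₁, ψ₂}`, then a vector of `span {ψ₁, ψ₂}`
orthogonal to `e₁` and `e₂` vanishes (`span {e₁, e₂} = span {ψ₁, ψ₂}` by dimension count).
[folklore] -/
theorem eq_zero_of_orthogonal_of_mem_span {ψ₁ ψ₂ e₁ e₂ χ : ι → ℂ}
    (he₁ : ∃ a b : ℂ, e₁ = a • ψ₁ + b • ψ₂) (he₂ : ∃ a b : ℂ, e₂ = a • ψ₁ + b • ψ₂)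
    (hχ : ∃ a b : ℂ, χ = a • ψ₁ + b • ψ₂) (h11 : star e₁ ⬝ᵥ e₁ = 1) (h22 : star e₂ ⬝ᵥ e₂ = 1)
    (h12 : star e₁ ⬝ᵥ e₂ = 0) (h1 : star e₁ ⬝ᵥ χ = 0) (h2 : star e₂ ⬝ᵥ χ = 0) : χ = 0 := by
  have h21 : star e₂ ⬝ᵥ e₁ = 0 := by rw [star_dotProduct, h12, star_zero]
  set P : Submodule ℂ (ι → ℂ) := Submodule.span ℂ (Set.range ![ψ₁, ψ₂]) with hP
  have hmem : ∀ {v : ι → ℂ}, (∃ a b : ℂ, v = a • ψ₁ + b • ψ₂) → v ∈ P := by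
    rintro v ⟨a, b, rfl⟩
    exact P.add_mem (P.smul_mem a (Submodule.subset_span ⟨0, rfl⟩))
      (P.smul_mem b (Submodule.subset_span ⟨1, rfl⟩))
  have hPle : Module.finrank ℂ P ≤ 2 := by
    have h := finrank_range_le_card (R := ℂ) ![ψ₁, ψ₂]
    rwa [Fintype.card_fin] at h
  have hli : LinearIndependent ℂ ![e₁, e₂] := by
    rw [LinearIndependent.pair_iff]
    intro s t hst
    have hs := congr_arg (fun v => star e₁ ⬝ᵥ v) hst
    have ht := congr_arg (fun v => star e₂ ⬝ᵥ v) hst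
    simp only [dotProduct_add, dotProduct_smul, h11, h12, h21, h22, smul_eq_mul, mul_one,
      mul_zero, add_zero, zero_add, dotProduct_zero] at hs ht
    exact ⟨hs, ht⟩
  set E : Submodule ℂ (ι → ℂ) := Submodule.span ℂ (Set.range ![e₁, e₂]) with hE
  have hEcard : Module.finrank ℂ E = 2 := by
    rw [hE, finrank_span_eq_card hli, Fintype.card_fin]
  have hEP : E ≤ P := by
    rw [hE, Submodule.span_le, Set.range_subset_iff, Fin.forall_fin_two]
    exact ⟨hmem he₁, hmem he₂⟩
  have hEP' : E = P := Submodule.eq_of_le_of_finrank_le hEP (by rw [hEcard]; exact hPle)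
  have hχE : χ ∈ E := by
    rw [hEP']
    exact hmem hχ
  rw [hE, Submodule.mem_span_range_iff_exists_fun] at hχE
  obtain ⟨c, hc⟩ := hχE
  rw [Fin.sum_univ_two] at hc
  simp only [Matrix.cons_val_zero, Matrix.cons_val_one] at hc
  have hc0 := congr_arg (fun v => star e₁ ⬝ᵥ v) hc
  have hc1 := congr_arg (fun v => star e₂ ⬝ᵥ v) hc
  simp only [dotProduct_add, dotProduct_smul, h11, h12, h21, h22, h1, h2, smul_eq_mul, mul_one,
    mul_zero, add_zero, zero_add] at hc0 hc1
  rw [← hc, hc0, hc1, zero_smul, zero_smul, add_zero]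

/-! ### The real frame and the gap at a two-fold level -/

/-- **Real orthonormal frame and spectral gap at an exactly two-fold sector level.** Let `A` be
Hermitian, preserving the sector `K`, with `E₀` a lower bound of its Rayleigh quotient on the unit
vectors of `K`, and suppose the `E₀`-eigenvectors of `A` in `K` are exactly the nonzero vectors of
`span {ψ₁, ψ₂}` with `ψ₁ ⊥ ψ₂`. Let `T` be an antiunitary involution preserving `K` and commuting
with `A`. Then the `E₀`-eigenspace in `K` has a `T`-real orthonormal basis `e₁, e₂`, and the
Rayleigh quotient on the unit vectors of `K` orthogonal to `e₁, e₂` is `≥ E₀ + g` for some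
`g > 0`. Kato (1966) I §6; Wigner (1932) / Hatsugai (2006) for the real structure. [folklore] -/
theorem stub_coneFrame {ι : Type*} [Fintype ι] [DecidableEq ι]
    (K : Submodule ℂ (ι → ℂ)) (A : Matrix ι ι ℂ) (hA : A.IsHermitian) (hAK : ∀ v ∈ K, A *ᵥ v ∈ K)
    (E₀ : ℝ) (hlb : ∀ v ∈ K, star v ⬝ᵥ v = 1 → E₀ ≤ (star v ⬝ᵥ A *ᵥ v).re)
    (T : (ι → ℂ) → (ι → ℂ)) (hTs : ∀ (c : ℂ) (v : ι → ℂ), T (c • v) = star c • T v)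
    (hTadd : ∀ u v : ι → ℂ, T (u + v) = T u + T v) (hTT : ∀ v : ι → ℂ, T (T v) = v)
    (hTK : ∀ v ∈ K, T v ∈ K) (hTA : ∀ v : ι → ℂ, T (A *ᵥ v) = A *ᵥ T v)
    (hTd : ∀ u v : ι → ℂ, star (T u) ⬝ᵥ T v = star (star u ⬝ᵥ v))
    (h2 : ∃ ψ₁ ψ₂ : ι → ℂ, (ψ₁ ∈ K ∧ ψ₁ ≠ 0 ∧ A *ᵥ ψ₁ = ((E₀ : ℝ) : ℂ) • ψ₁) ∧
      (ψ₂ ∈ K ∧ ψ₂ ≠ 0 ∧ A *ᵥ ψ₂ = ((E₀ : ℝ) : ℂ) • ψ₂) ∧ star ψ₁ ⬝ᵥ ψ₂ = 0 ∧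
      ∀ χ : ι → ℂ, (χ ∈ K ∧ χ ≠ 0 ∧ A *ᵥ χ = ((E₀ : ℝ) : ℂ) • χ) → ∃ z₁ z₂ : ℂ, χ = z₁ • ψ₁ + z₂ • ψ₂) :
    ∃ e₁ e₂ : ι → ℂ, e₁ ∈ K ∧ e₂ ∈ K ∧ T e₁ = e₁ ∧ T e₂ = e₂ ∧ star e₁ ⬝ᵥ e₁ = 1 ∧
      star e₂ ⬝ᵥ e₂ = 1 ∧ star e₁ ⬝ᵥ e₂ = 0 ∧ A *ᵥ e₁ = ((E₀ : ℝ) : ℂ) • e₁ ∧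
      A *ᵥ e₂ = ((E₀ : ℝ) : ℂ) • e₂ ∧
      ∃ g : ℝ, 0 < g ∧ ∀ χ ∈ K, star e₁ ⬝ᵥ χ = 0 → star e₂ ⬝ᵥ χ = 0 → star χ ⬝ᵥ χ = 1 →
        E₀ + g ≤ (star χ ⬝ᵥ A *ᵥ χ).re := by
  obtain ⟨ψ₁, ψ₂, ⟨hψ₁K, hψ₁0, hψ₁A⟩, ⟨hψ₂K, hψ₂0, hψ₂A⟩, hψ12, hspan⟩ := h2
  -- the eigen-sector `V = {v ∈ K | A v = E₀ v}` as a submodule, stable under `T`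
  set V : Submodule ℂ (ι → ℂ) := K ⊓ Module.End.eigenspace (Matrix.toLin' A) ((E₀ : ℝ) : ℂ)
    with hVdef
  have hV : ∀ v, v ∈ V ↔ v ∈ K ∧ A *ᵥ v = ((E₀ : ℝ) : ℂ) • v := fun v => by
    rw [hVdef, Submodule.mem_inf, Module.End.mem_eigenspace_iff, Matrix.toLin'_apply]
  have hE₀ : star ((E₀ : ℝ) : ℂ) = ((E₀ : ℝ) : ℂ) := by rw [Complex.star_def, Complex.conj_ofReal]
  have hTV : ∀ v ∈ V, T v ∈ V := fun v hv => by
    rw [hV] at hv ⊢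
    exact ⟨hTK v hv.1, by rw [← hTA, hv.2, hTs, hE₀]⟩
  have hT0 : T 0 = 0 := by
    have h := hTs 0 0
    rwa [zero_smul, star_zero, zero_smul] at h
  have hTreal : ∀ (r : ℝ) (f : ι → ℂ), T f = f → T ((r : ℂ) • f) = (r : ℂ) • f :=
    fun r f hf => by rw [hTs, hf, Complex.star_def, Complex.conj_ofReal]
  -- `e₁`: realify `ψ₁` and normalise by a real scalar
  obtain ⟨f₁, hf₁V, hf₁0, hTf₁, -⟩ := exists_fixed_of_antiunitary hTs hTadd hTT hTd V hTV
    ((hV ψ₁).2 ⟨hψ₁K, hψ₁A⟩) hψ₁0 hT0 (by rw [star_zero, zero_dotProduct])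
  obtain ⟨r₁, hr₁⟩ := exists_ofReal_smul_unit hf₁0
  set e₁ : ι → ℂ := (r₁ : ℂ) • f₁ with he₁def
  have he₁V : e₁ ∈ V := V.smul_mem _ hf₁V
  have hTe₁ : T e₁ = e₁ := hTreal r₁ f₁ hTf₁
  -- a nonzero vector of `V` orthogonal to `e₁` (Gram–Schmidt on `ψ₁` or `ψ₂`)
  have hproj : ∀ ψ ∈ V, ψ - (star e₁ ⬝ᵥ ψ) • e₁ ∈ V ∧
      star e₁ ⬝ᵥ (ψ - (star e₁ ⬝ᵥ ψ) • e₁) = 0 := fun ψ hψ =>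
    ⟨V.sub_mem hψ (V.smul_mem _ he₁V), by
      rw [dotProduct_sub, dotProduct_smul, hr₁, smul_eq_mul, mul_one, sub_self]⟩
  obtain ⟨w, hwV, hw0, hew⟩ : ∃ w ∈ V, w ≠ 0 ∧ star e₁ ⬝ᵥ w = 0 := by
    by_cases hw₁ : ψ₁ - (star e₁ ⬝ᵥ ψ₁) • e₁ = 0
    · by_cases hw₂ : ψ₂ - (star e₁ ⬝ᵥ ψ₂) • e₁ = 0
      · exfalso
        rw [sub_eq_zero] at hw₁ hw₂
        have h := hψ12
        rw [hw₁, hw₂, star_smul, smul_dotProduct, dotProduct_smul, hr₁, smul_eq_mul, smul_eq_mul,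
          mul_one, mul_eq_zero] at h
        rcases h with h | h
        · rw [star_eq_zero] at h
          rw [h, zero_smul] at hw₁
          exact hψ₁0 hw₁
        · rw [h, zero_smul] at hw₂
          exact hψ₂0 hw₂
      · have h := hproj ψ₂ ((hV ψ₂).2 ⟨hψ₂K, hψ₂A⟩)
        exact ⟨_, h.1, hw₂, h.2⟩
    · have h := hproj ψ₁ ((hV ψ₁).2 ⟨hψ₁K, hψ₁A⟩)
      exact ⟨_, h.1, hw₁, h.2⟩
  -- `e₂`: realify `w` (staying orthogonal to the real `e₁`) and normalise
  obtain ⟨f₂, hf₂V, hf₂0, hTf₂, hef₂⟩ :=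
    exists_fixed_of_antiunitary hTs hTadd hTT hTd V hTV hwV hw0 hTe₁ hew
  obtain ⟨r₂, hr₂⟩ := exists_ofReal_smul_unit hf₂0
  set e₂ : ι → ℂ := (r₂ : ℂ) • f₂ with he₂def
  have he₂V : e₂ ∈ V := V.smul_mem _ hf₂V
  have hTe₂ : T e₂ = e₂ := hTreal r₂ f₂ hTf₂
  have he₁₂ : star e₁ ⬝ᵥ e₂ = 0 := by rw [he₂def, dotProduct_smul, hef₂, smul_zero]
  obtain ⟨he₁K, he₁A⟩ := (hV e₁).1 he₁V
  obtain ⟨he₂K, he₂A⟩ := (hV e₂).1 he₂V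
  refine ⟨e₁, e₂, he₁K, he₂K, hTe₁, hTe₂, hr₁, hr₂, he₁₂, he₁A, he₂A, ?_⟩
  -- the gap: minimise the Rayleigh quotient on the compact set `S` of unit vectors of `K`
  -- orthogonal to `e₁, e₂`
  set S : Set (ι → ℂ) :=
    {χ | χ ∈ K ∧ star e₁ ⬝ᵥ χ = 0 ∧ star e₂ ⬝ᵥ χ = 0 ∧ star χ ⬝ᵥ χ = 1} with hSdef
  have hSc : IsCompact S := by
    refine isCompact_unitSphere.of_isClosed_subset ?_ fun χ hχ => hχ.2.2.2
    have hK : IsClosed (K : Set (ι → ℂ)) := K.closed_of_finiteDimensional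
    have hc : ∀ e : ι → ℂ, Continuous fun χ : ι → ℂ => star e ⬝ᵥ χ := fun e =>
      continuous_const.dotProduct continuous_id
    simp only [hSdef, Set.setOf_and]
    exact hK.inter ((isClosed_eq (hc e₁) continuous_const).inter
      ((isClosed_eq (hc e₂) continuous_const).inter
        (isClosed_eq (continuous_id.star.dotProduct continuous_id) continuous_const)))
  have hRc : Continuous fun χ : ι → ℂ => (star χ ⬝ᵥ A *ᵥ χ).re :=
    Complex.continuous_re.comp
      (continuous_id.star.dotProduct (continuous_const.matrix_mulVec continuous_id))
  by_cases hSne : S.Nonempty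
  · obtain ⟨χ₀, hχ₀, hmin⟩ := hSc.exists_isMinOn hSne hRc.continuousOn
    obtain ⟨hχ₀K, hχ₀1, hχ₀2, hχ₀u⟩ := hχ₀
    have hgap : E₀ < (star χ₀ ⬝ᵥ A *ᵥ χ₀).re := by
      refine lt_of_le_of_ne (hlb χ₀ hχ₀K hχ₀u) fun hEq => ?_
      -- if the minimum were `E₀`, `χ₀` would be an `E₀`-eigenvector (variational lemma on `K`)
      have hB : (A - ((E₀ : ℝ) : ℂ) • (1 : Matrix ι ι ℂ)).IsHermitian := by
        unfold Matrix.IsHermitian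
        rw [conjTranspose_sub, conjTranspose_smul, conjTranspose_one, hA.eq, hE₀]
      have hBv : ∀ v : ι → ℂ, (A - ((E₀ : ℝ) : ℂ) • (1 : Matrix ι ι ℂ)) *ᵥ v =
          A *ᵥ v - ((E₀ : ℝ) : ℂ) • v := fun v => by
        rw [sub_mulVec, smul_mulVec, one_mulVec]
      have hBform : ∀ v : ι → ℂ, (star v ⬝ᵥ (A - ((E₀ : ℝ) : ℂ) • (1 : Matrix ι ι ℂ)) *ᵥ v).re =
          (star v ⬝ᵥ A *ᵥ v).re - E₀ * (star v ⬝ᵥ v).re := fun v => by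
        rw [hBv, dotProduct_sub, dotProduct_smul, smul_eq_mul, Complex.sub_re,
          Complex.re_ofReal_mul]
      have hpos : ∀ w ∈ K, 0 ≤ (star w ⬝ᵥ (A - ((E₀ : ℝ) : ℂ) • (1 : Matrix ι ι ℂ)) *ᵥ w).re :=
        fun w hw => by
          rw [hBform]
          have h := mul_re_le_rayleigh_of_unit K hlb w hw
          linarith
      have h0 : (star χ₀ ⬝ᵥ (A - ((E₀ : ℝ) : ℂ) • (1 : Matrix ι ι ℂ)) *ᵥ χ₀).re = 0 := by
        rw [hBform, hχ₀u, Complex.one_re, mul_one, ← hEq, sub_self]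
      have hperp := dotProduct_mulVec_eq_zero_of_form_eq_zero hB K hpos hχ₀K h0
      have hBχ₀K : (A - ((E₀ : ℝ) : ℂ) • (1 : Matrix ι ι ℂ)) *ᵥ χ₀ ∈ K := by
        rw [hBv]
        exact K.sub_mem (hAK χ₀ hχ₀K) (K.smul_mem _ hχ₀K)
      have hBχ₀ := dotProduct_star_self_eq_zero.1 (hperp _ hBχ₀K)
      rw [hBv, sub_eq_zero] at hBχ₀
      have hχ₀0 : χ₀ ≠ 0 := ne_zero_of_unit hχ₀u
      obtain ⟨a₁, a₂, ha⟩ := hspan e₁ ⟨he₁K, ne_zero_of_unit hr₁, he₁A⟩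
      obtain ⟨b₁, b₂, hb⟩ := hspan e₂ ⟨he₂K, ne_zero_of_unit hr₂, he₂A⟩
      obtain ⟨z₁, z₂, hz⟩ := hspan χ₀ ⟨hχ₀K, hχ₀0, hBχ₀⟩
      exact hχ₀0 (eq_zero_of_orthogonal_of_mem_span ⟨a₁, a₂, ha⟩ ⟨b₁, b₂, hb⟩ ⟨z₁, z₂, hz⟩
        hr₁ hr₂ he₁₂ hχ₀1 hχ₀2)
    refine ⟨(star χ₀ ⬝ᵥ A *ᵥ χ₀).re - E₀, sub_pos.2 hgap, fun χ hχK h1 h2 hu => ?_⟩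
    have h := (isMinOn_iff.1 hmin) χ ⟨hχK, h1, h2, hu⟩
    linarith
  · exact ⟨1, one_pos, fun χ hχK h1 h2 hu => (hSne ⟨χ, hχK, h1, h2, hu⟩).elim⟩

end Summit.HubbardSuperconductivity.HubbardSuperconductivity.Theorems.NodalDiracTwist
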